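import Literature.MathematicalPhysics.QuantumFieldTheory.Balaban1983to89.B8Eq131CubesAdmissible
import Literature.MathematicalPhysics.QuantumFieldTheory.Balaban1983to89.B8SectAStatements
import Literature.MathematicalPhysics.QuantumFieldTheory.Balaban1983to89.B7BlockGeometry

/-!
# `Balaban1983to89.B8Eq134Admissible` — T. Bałaban, *Spaces of regular gauge field configurations on a lattice and gauge
# fixing conditions*, Commun. Math. Phys. **99** (1985) 75–102 [Balaban1985RegularSpaces] ("B8"), **(1.3)–(1.4)** p. 77:
# THE ADMISSIBLE SEQUENCE OF DOMAINS `{Ω_j}` AS ONE PREDICATE ON A GENERAL FAMILY — the big-cube clause «Ω_j is a sum of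
# cubes of a size M₁Lʲη» typed for a general family, the four clauses assembled (`Admissible134`), the kernel implication
# to the `ℤ^d` record `B8ConstraintBonds.DomainSeq`, and the instance for the Sect. F cube family of `B8Eq131CubesAdmissible`

statement-level skeleton of published theorems with citation tags; proofs where landed; nothing here is a claim about the
Yang–Mills mass gap

PDF held: `paper:balaban1985-cmp99-regular-spaces-gauge-fixing` (journal page = PDF page + 74); p. 77 [PDF 3] read this
session AS AN IMAGE on the ×2 render `run/shared/lean/pub/pub-balaban/b2b-balaban-ref1/pages/1985-cmp99-regular-spaces-
gauge-fixing/…-p003-x2.png`.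

CITATION HEADER (lean-in-tree rule).  Part of the lit-balaban TYPED SKELETON (HOME `run/shared/lean/pub/lit-balaban/`), unit
`lit-balaban-r13` gen 99 (free-target protocol G.5-34(d), on the written welcome of the row owner r05 g69, 2026-08-23).
Serves row `B8.Eq1.3` of `HOME/lit-balaban-r05/ROWS-B8.md`: it is the OWED MEMBER named by the owner's audit
`HOME/lit-balaban-r05/READING-RULE-AUDIT-B8-g69.md` §3.1 («(1.4)₂ "Ω_j is a sum of cubes of a size M₁Lʲη" is not typed as a
predicate on a GENERAL family {Ω_j} (only its instance for the Sect. F cubes is a theorem), and the three clauses are not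
assembled into one "admissible sequence" predicate; (1.4)₃ is typed but not bridged to `DomainSeq.sep` by a kernel implication.
OWED MEMBER: `BigCubes14` …, `Admissible134 := anti ∧ sat ∧ BigCubes14 ∧ MetricClause14 (ℓ^∞ lattice distance)`, the instance
`admissible134_cubeFam` from p347515's three lemmas, and `Admissible134 → DomainSeq` for RM₁ ≥ L»).  Nothing landed is
edited or restated: `B8ConstraintBonds.DomainSeq` (nesting `anti`, block saturation `sat`, collar `sep`),
`B8SectAStatements.MetricClause14` (r05 g1 v1.1 p239870: the distance clause of (1.4) pointwise over a supplied distance),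
`B8Eq131CubesAdmissible` (r05 g56 p347515: `cubeFam`, `cubeFam_domainSeq`, `sep_cube`, `sq_blockSat`), `B8Eq131Cubes`
(`cube`, `flm`, `mem_cube_iff`, `under_flm`), `B7BlockGeometry.blockMap_blockMap` and `QuantumLattice.blockMap` are imported
and used BY NAME.

THE PRINTED TEXT.  p. 77 [PDF 3], verbatim: *"To formulate the notion of regularity we have to describe at first a geometric
setting. We consider a sequence of domains (see also [2.II, 4]) Ω₀ ⊃ Ω₁ ⊃ Ω₂ ⊃ … ⊃ Ω_k, Ω_j ⊂ T_η, j = 0, 1, …, k, (1.3) which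
satisfy the following conditions: Ω_j = Bʲ(Ω_j^{(j)}), Ω_j is a sum of cubes of a size M₁Lʲη, (Lʲη)⁻¹dist(Ω_jᶜ, Ω_{j+1}) >
RM₁. (1.4) The number M₁ is a size of big blocks and was fixed in [4]. It is much bigger than δ₀⁻¹, where δ₀ is a decay rate
of propagators, and it depends on d and L only. We assume that R is a sufficiently large positive integer (a power of L),
so that all the theorems on propagators in [2, 4] hold for RM₁. … Let us notice that we admit the case where some domains
Ω_j are equal to T_η, for example Ω_j = T_η for j = 0, 1, …, l, l ≦ k."*

WHAT IS TYPED AND PROVED (definitions WITH BODY + theorems; no `Prop`-valued fact).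
* §1 `supDist` — the `ℓ^∞` lattice distance on the sites of `ℤ^d` (the distance the row owner's audit names for (1.4)₃),
  with `le_supDist` / `supDist_le_of_forall`.
* §2 **`BigCubes14 L M₁ Ω`** — (1.4)₂ «Ω_j is a sum of cubes of a size M₁Lʲη» FOR A GENERAL FAMILY `Ω : ℕ → Set (ℤ^d)`:
  every `Ω_j` is saturated for the partition of `ℤ^d` into the cubes of side `M₁Lʲ` (fibres of `blockMap (M₁·Lʲ)`);
  `blockSat_of_bigCubes14` — it implies (1.4)₁ «Ω_j = Bʲ(Ω_j^{(j)})» (saturation for the `Lʲ`-blocks: an `M₁Lʲ`-cube is a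
  union of `Lʲ`-blocks, `B7BlockGeometry.blockMap_blockMap`).
* §3 **`Admissible134 L M₁ R k Ω`** — (1.3)–(1.4) AS ONE PREDICATE: `nested` (1.3) «Ω₀ ⊃ Ω₁ ⊃ … ⊃ Ω_k»; `beyond` (the
  sequence stops at `k`: `Ω_j = ∅` for `j > k`, the `ℕ → Set` encoding of `B8ConstraintBonds`); `blockSat` (1.4)₁;
  `bigCubes` (1.4)₂; `metric` (1.4)₃ = `B8SectAStatements.MetricClause14 supDist Ω k 1 L R M₁` (scaled coordinates `η = 1`);
  `Admissible134.of_le` («R sufficiently large»: monotone in `R`, by `metricClause14_anti`).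
* §4 **`Admissible134.domainSeq`** — THE KERNEL IMPLICATION to the record the certificates consume: for `1 ≤ L ≤ RM₁`,
  `Admissible134 L M₁ R k Ω → B8ConstraintBonds.DomainSeq L Ω`; its heart `sep_of_metricClause14` bridges (1.4)₃ to
  `DomainSeq.sep` (the `ℓ^∞`-ball of radius `L^{n+1}` about `Ω_{n+1}` lies in `Ω_n`: a point `x + t`, `|t|_∞ ≤ L^{n+1}`, outside
  `Ω_n` would be at scaled distance `≤ L ≤ RM₁` from `x ∈ Ω_{n+1}`, contradicting «> RM₁»).
* §5 **`admissible134_cubeFam`** / **`admissible134_cubeFam_printed`** — THE INSTANCE for the Sect. F cube family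
  `B8Eq131CubesAdmissible.cubeFam top L a M ρ k` (p. 99 «The sequence of cubes {□_j} is an admissible family of subsets
  satisfying (1.3), (1.4)»): `nested`/`blockSat` = `cubeFam_domainSeq` BY NAME, `bigCubes` = `sq_blockSat` BY NAME (block side
  `M₁` dividing the separation constant `ρ = R₁M₁`, the corner `a` and the side `M` — print p. 98: «□ is a union of cubes of the
  size R₁M₁Lʲη», «M a multiple of R₁M₁»), `metric` = `sep_cube` BY NAME (with `R·M₁ ≤ ρ`; printed: `ρ = R₁M₁`, `R = R₁`);
  and the trivial admissible family `univFam k` («we admit the case where some domains Ω_j are equal to T_η»).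
HONEST SCOPE.  (i) `ℤ^d` carrier in scaled coordinates (`η = 1`), as every B7/B8 `ℤ^d` file; print's `T_η` is a torus and
«dist» is not specified there — the `ℓ^∞` lattice distance is used (the audit's choice; `B8ConstraintBonds`: «`RM₁ ≥ L` for the
`ℓ^∞` distance, `RM₁ ≥ √d·L` for the Euclidean one — the paper does not say which dist is meant»); with the Euclidean or `ℓ¹`
distance the clause is weaker/stronger by dimension factors only.  (ii) ZERO-WEIGHT SENTENCES of the row (named, not typed):
«The number M₁ is a size of big blocks and was fixed in [4]. It is much bigger than δ₀⁻¹ … depends on d and L only» (a recall of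
[4]'s constant — here `M₁` is a parameter), «We assume that R is a sufficiently large positive integer (a power of L), so that
all the theorems on propagators in [2, 4] hold for RM₁» (a cross-paper premise — here `R` is a parameter; the implication
§4 needs only `RM₁ ≥ L`), «see also [2.II, 4]» (pointer).  (iii) (1.3)'s «Ω_j ⊂ T_η» is the typing `Ω j : Set (Fin d → ℤ)`.
(iv) For the cube family (1.4)₃ holds with print's minimal constant `R₁M₁` of p. 98 in the place of `RM₁`, exactly as
`B8Eq131CubesAdmissible` records (HONEST SCOPE (ii) there).  Nothing here is new mathematics; imports Literature only;
standard axioms.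
-/

namespace Literature.MathematicalPhysics.QuantumFieldTheory.Balaban1983to89.B8Eq134Admissible

open Literature.MathematicalPhysics.QuantumLattice (blockMap)
open B8ConstraintBonds (DomainSeq)
open B8SectAStatements (MetricClause14 metricClause14_anti)
open B7BlockGeometry (blockMap_blockMap)
open B8Ineq132 (Under)
open B8Eq131Cubes (cube flm mem_cube_iff under_flm)
open B8Eq131CubesAdmissible (cubeFam cubeFam_domainSeq cubeFam_of_pos cubeFam_of_lt cubeFam_true_zero sep_cube
  sq_blockSat)

variable {d : ℕ}

/-! ## §1 The `ℓ^∞` lattice distance -/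

/-- The `ℓ^∞` lattice distance `max_μ |x_μ − y_μ|` on the sites of `ℤ^d` (in units of the fine spacing `η`), as a real
number — the distance used for «dist» in (1.4) (the paper does not specify the norm; cf. `B8ConstraintBonds.DomainSeq`).
[cite: Balaban1985RegularSpaces, (1.4) p.77] -/
def supDist (x y : Fin d → ℤ) : ℝ := ((Finset.univ.sup fun i => (x i - y i).natAbs : ℕ) : ℝ)

/-- Every coordinate difference is bounded by the `ℓ^∞` distance. [cite: Balaban1985RegularSpaces, (1.4) p.77] -/
theorem le_supDist (x y : Fin d → ℤ) (i : Fin d) : ((x i - y i).natAbs : ℝ) ≤ supDist x y := by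
  unfold supDist
  exact_mod_cast Finset.le_sup (f := fun i => (x i - y i).natAbs) (Finset.mem_univ i)

/-- A uniform bound on the coordinate differences bounds the `ℓ^∞` distance. [cite: Balaban1985RegularSpaces, (1.4) p.77] -/
theorem supDist_le_of_forall {x y : Fin d → ℤ} {B : ℕ} (h : ∀ i, (x i - y i).natAbs ≤ B) : supDist x y ≤ B := by
  unfold supDist
  exact_mod_cast Finset.sup_le fun i _ => h i

/-! ## §2 (1.4)₂ «Ω_j is a sum of cubes of a size M₁Lʲη» for a general family -/

/-- **(1.4), second clause, FOR A GENERAL FAMILY** p. 77, verbatim: *"Ω_j is a sum of cubes of a size M₁Lʲη"* — every `Ω_j`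
is a union of cubes of the partition of `ℤ^d` into cubes of side `M₁Lʲ` (corner cubes `{x : ⌊x/(M₁Lʲ)⌋ = z}`), i.e. `Ω_j`
is saturated for `blockMap (M₁·Lʲ)`. [cite: Balaban1985RegularSpaces, (1.4) p.77] -/
def BigCubes14 (L M₁ : ℕ) (Ω : ℕ → Set (Fin d → ℤ)) : Prop :=
  ∀ (j : ℕ) (x y : Fin d → ℤ), blockMap (M₁ * L ^ j) x = blockMap (M₁ * L ^ j) y → x ∈ Ω j → y ∈ Ω j

/-- Unfolding of `BigCubes14`. [cite: Balaban1985RegularSpaces, (1.4) p.77] -/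
theorem bigCubes14_iff (L M₁ : ℕ) (Ω : ℕ → Set (Fin d → ℤ)) :
    BigCubes14 L M₁ Ω ↔
      ∀ (j : ℕ) (x y : Fin d → ℤ), blockMap (M₁ * L ^ j) x = blockMap (M₁ * L ^ j) y → x ∈ Ω j → y ∈ Ω j :=
  Iff.rfl

/-- (1.4)₂ implies (1.4)₁ «Ω_j = Bʲ(Ω_j^{(j)})»: a union of `M₁Lʲ`-cubes is a union of `Lʲ`-blocks (each `M₁Lʲ`-cube is the
union of the `Lʲ`-blocks it contains: `⌊⌊x/Lʲ⌋/M₁⌋ = ⌊x/(LʲM₁)⌋`, `B7BlockGeometry.blockMap_blockMap`).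
[cite: Balaban1985RegularSpaces, (1.4) p.77] -/
theorem blockSat_of_bigCubes14 {L M₁ : ℕ} {Ω : ℕ → Set (Fin d → ℤ)} (h : BigCubes14 L M₁ Ω) (j : ℕ)
    (x y : Fin d → ℤ) (hxy : blockMap (L ^ j) x = blockMap (L ^ j) y) (hx : x ∈ Ω j) : y ∈ Ω j := by
  refine h j x y ?_ hx
  rw [mul_comm, ← blockMap_blockMap (L ^ j) M₁ x, ← blockMap_blockMap (L ^ j) M₁ y, hxy]

/-! ## §3 (1.3)–(1.4): the admissible sequence of domains, one predicate -/

/-- **(1.3)–(1.4) AS ONE PREDICATE** p. 77, verbatim: *"We consider a sequence of domains (see also [2.II, 4]) Ω₀ ⊃ Ω₁ ⊃ Ω₂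
⊃ … ⊃ Ω_k, Ω_j ⊂ T_η, j = 0, 1, …, k, (1.3) which satisfy the following conditions: Ω_j = Bʲ(Ω_j^{(j)}), Ω_j is a sum of
cubes of a size M₁Lʲη, (Lʲη)⁻¹dist(Ω_jᶜ, Ω_{j+1}) > RM₁. (1.4)"* — on the `ℤ^d` carrier in scaled coordinates (`η = 1`),
the family encoded as `Ω : ℕ → Set (ℤ^d)` with `Ω_j = ∅` beyond `k` (the convention of `B8ConstraintBonds`):
* `nested` — (1.3) «Ω₀ ⊃ Ω₁ ⊃ … ⊃ Ω_k»;
* `beyond` — the sequence ends at `k`;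
* `blockSat` — (1.4)₁ «Ω_j = Bʲ(Ω_j^{(j)})» (saturation for `blockMap (Lʲ)`; implied by `bigCubes`, `blockSat_of_bigCubes14`,
  kept as printed);
* `bigCubes` — (1.4)₂ «Ω_j is a sum of cubes of a size M₁Lʲη» (`BigCubes14`);
* `metric` — (1.4)₃ «(Lʲη)⁻¹dist(Ω_jᶜ, Ω_{j+1}) > RM₁», `j < k`, for the `ℓ^∞` lattice distance
  (`B8SectAStatements.MetricClause14 supDist Ω k 1 L R M₁`).
[cite: Balaban1985RegularSpaces, (1.3)–(1.4) p.77] -/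
structure Admissible134 (L M₁ R k : ℕ) (Ω : ℕ → Set (Fin d → ℤ)) : Prop where
  nested : ∀ j, Ω (j + 1) ⊆ Ω j
  beyond : ∀ j, k < j → Ω j = ∅
  blockSat : ∀ (j : ℕ) (x y : Fin d → ℤ), blockMap (L ^ j) x = blockMap (L ^ j) y → x ∈ Ω j → y ∈ Ω j
  bigCubes : BigCubes14 L M₁ Ω
  metric : MetricClause14 supDist Ω k 1 L R M₁

namespace Admissible134

variable {L M₁ R k : ℕ} {Ω : ℕ → Set (Fin d → ℤ)}

/-- (1.3) iterated: `Ω_m ⊆ Ω_n` for `n ≤ m`. [cite: Balaban1985RegularSpaces, (1.3) p.77] -/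
theorem anti_le (h : Admissible134 L M₁ R k Ω) {n m : ℕ} (hnm : n ≤ m) : Ω m ⊆ Ω n :=
  antitone_nat_of_succ_le h.nested hnm

/-- «We assume that R is a sufficiently large positive integer»: admissibility with the separation constant `R` implies
admissibility with any smaller `R′` (`B8SectAStatements.metricClause14_anti`). [cite: Balaban1985RegularSpaces, (1.4) p.77] -/
theorem of_le (h : Admissible134 L M₁ R k Ω) {R' : ℕ} (hR : R' ≤ R) : Admissible134 L M₁ R' k Ω :=
  ⟨h.nested, h.beyond, h.blockSat, h.bigCubes, metricClause14_anti hR h.metric⟩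

/-- The constructor with (1.4)₁ DERIVED from (1.4)₂ (`blockSat_of_bigCubes14`): nesting, the stop at `k`, the big-cube
clause and the metric clause already make an admissible sequence. [cite: Balaban1985RegularSpaces, (1.3)–(1.4) p.77] -/
theorem of_bigCubes (hn : ∀ j, Ω (j + 1) ⊆ Ω j) (hb : ∀ j, k < j → Ω j = ∅) (hc : BigCubes14 L M₁ Ω)
    (hm : MetricClause14 supDist Ω k 1 L R M₁) : Admissible134 L M₁ R k Ω :=
  ⟨hn, hb, blockSat_of_bigCubes14 hc, hc, hm⟩

end Admissible134

/-! ## §4 The kernel implication `Admissible134 → B8ConstraintBonds.DomainSeq` (`RM₁ ≥ L`) -/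

/-- **(1.4)₃ ⇒ `DomainSeq.sep`.** Under the metric clause for the `ℓ^∞` distance with `RM₁ ≥ L` (and `Ω_j = ∅` beyond `k`),
the `ℓ^∞`-ball of radius `L^{n+1}` about a point of `Ω_{n+1}` lies in `Ω_n`: a point `x + t`, `|t|_∞ ≤ L^{n+1}`, outside
`Ω_n` would give `(Lⁿ)⁻¹dist ≤ L ≤ RM₁`, contradicting «> RM₁» — the consequence of (1.4) that `B8ConstraintBonds.DomainSeq`
records as its field `sep` («`RM₁ ≥ L` for the `ℓ^∞` distance»). [cite: Balaban1985RegularSpaces, (1.4) p.77] -/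
theorem sep_of_metricClause14 {L M₁ R k : ℕ} {Ω : ℕ → Set (Fin d → ℤ)} (hL : 1 ≤ L) (hRM : L ≤ R * M₁)
    (hmet : MetricClause14 supDist Ω k 1 L R M₁) (hbeyond : ∀ j, k < j → Ω j = ∅)
    (n : ℕ) (x t : Fin d → ℤ) (hx : x ∈ Ω (n + 1)) (ht : ∀ i, |t i| ≤ (L : ℤ) ^ (n + 1)) : x + t ∈ Ω n := by
  by_cases hn : n < k
  · by_contra hxt
    have h := hmet n hn (x + t) hxt x hx
    have hsup : supDist (x + t) x ≤ ((L ^ (n + 1) : ℕ) : ℝ) := by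
      apply supDist_le_of_forall
      intro i
      have hi := ht i
      rw [Int.abs_eq_natAbs] at hi
      have : ((x + t) i - x i).natAbs = (t i).natAbs := by
        rw [Pi.add_apply, add_sub_cancel_left]
      rw [this]
      exact_mod_cast hi
    have hL0 : (0 : ℝ) < (L : ℝ) ^ n := by positivity
    have h2 : ((L : ℝ) ^ n * 1)⁻¹ * supDist (x + t) x ≤ L := by
      rw [mul_one]
      calc ((L : ℝ) ^ n)⁻¹ * supDist (x + t) x ≤ ((L : ℝ) ^ n)⁻¹ * ((L ^ (n + 1) : ℕ) : ℝ) :=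
            mul_le_mul_of_nonneg_left hsup (inv_nonneg.mpr hL0.le)
        _ = L := by push_cast; rw [pow_succ, ← mul_assoc, inv_mul_cancel₀ hL0.ne', one_mul]
    have h3 : (L : ℝ) ≤ (R : ℝ) * M₁ := by exact_mod_cast hRM
    linarith
  · rw [hbeyond (n + 1) (by omega)] at hx
    exact absurd hx (Set.notMem_empty _)

/-- **`Admissible134 → DomainSeq` for `RM₁ ≥ L`** (`L ≥ 1`): an admissible sequence (1.3)–(1.4) on `ℤ^d` is a domain sequence
in the sense of the `ℤ^d` record `B8ConstraintBonds.DomainSeq` consumed by the certificates of the B8 lineage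
(`anti` = `nested`, `sat` = `blockSat`, `sep` from the metric clause by `sep_of_metricClause14`).
[cite: Balaban1985RegularSpaces, (1.3)–(1.4) p.77] -/
theorem Admissible134.domainSeq {L M₁ R k : ℕ} {Ω : ℕ → Set (Fin d → ℤ)} (h : Admissible134 L M₁ R k Ω)
    (hL : 1 ≤ L) (hRM : L ≤ R * M₁) : DomainSeq L Ω :=
  ⟨h.nested, h.blockSat, sep_of_metricClause14 hL hRM h.metric h.beyond⟩

/-! ## §5 The instances: the Sect. F cube family of `B8Eq131CubesAdmissible`, and the trivial family -/

/-- `z ∈ Bʲ(x)`-membership determines the block label: `Under L j z x → blockMap (Lʲ) x = z` (floor-division plumbing).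
[folklore] -/
private theorem blockMap_pow_eq_of_under {L : ℕ} (hL : 1 ≤ L) {j : ℕ} {z x : Fin d → ℤ} (hz : Under L j z x) :
    blockMap (L ^ j) x = z := by
  funext i
  obtain ⟨h1, h2⟩ := hz i
  have hL0 : (0 : ℤ) < (L : ℤ) ^ j := by positivity
  show x i / ((L ^ j : ℕ) : ℤ) = z i
  push_cast
  have h1' : z i * (L : ℤ) ^ j ≤ x i := by rw [mul_comm]; exact h1
  have h2' : x i < (z i + 1) * (L : ℤ) ^ j := by rw [mul_comm]; omega
  have hq1 : z i ≤ x i / (L : ℤ) ^ j := Int.le_ediv_of_mul_le hL0 h1'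
  have hq2 : x i / (L : ℤ) ^ j < z i + 1 := Int.ediv_lt_of_lt_mul hL0 h2'
  omega

/-- The prelude's block map at block side `Lʲ` is `B8Eq131Cubes.flm` (floor-division plumbing). [folklore] -/
private theorem blockMap_pow_eq_flm (L j : ℕ) (x : Fin d → ℤ) : blockMap (L ^ j) x = flm L j x := by
  funext i
  simp [blockMap, flm]

/-- `Ω_j = □_j` for `j ≤ k` unless (`top` and `j = 0`) — the case split of `cubeFam` (bookkeeping). [folklore] -/
private theorem cubeFam_eq_cube' (top : Bool) (L : ℕ) (a : Fin d → ℤ) (M ρ : ℕ) {k j : ℕ} (hj : j ≤ k)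
    (h : ¬ (top = true ∧ j = 0)) : cubeFam top L a M ρ k j = cube L a M ρ k j := by
  simp [cubeFam, hj, h]

/-- **(1.4)₂ FOR THE SECT. F CUBE FAMILY**: for a block side `M₁ ≥ 1` dividing the separation constant `ρ` (`= R₁M₁`), the
lower corner `a` of `□^{(k)}` and its side `M` (print p. 98: «□ is a union of cubes of the size R₁M₁Lʲη», «M a multiple of
R₁M₁»), every `Ω_j` of `cubeFam top L a M ρ k` is a union of `M₁Lʲ`-cubes — `B8Eq131CubesAdmissible.sq_blockSat` BY NAME,
transported from the level-`j` coordinates to the fine lattice. [cite: Balaban1985RegularSpaces, (1.4) p.77, p.98] -/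
theorem bigCubes14_cubeFam (top : Bool) {L : ℕ} (hL : 1 ≤ L) (a : Fin d → ℤ) (M : ℕ) {ρ : ℕ} (k : ℕ) {M₁ : ℕ}
    (hM₁ : 1 ≤ M₁) (hM₁ρ : M₁ ∣ ρ) (hM₁a : ∀ i, (M₁ : ℤ) ∣ a i) (hM₁M : M₁ ∣ M) :
    BigCubes14 L M₁ (cubeFam top L a M ρ k) := by
  intro j x y hxy hx
  by_cases hj : j ≤ k
  · by_cases h0 : top = true ∧ j = 0
    · obtain ⟨rfl, rfl⟩ := h0
      rw [cubeFam_true_zero]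
      exact Set.mem_univ _
    · rw [cubeFam_eq_cube' top L a M ρ hj h0] at hx ⊢
      obtain ⟨z, hz, hU⟩ := (mem_cube_iff hL).mp hx
      have hzx : blockMap (L ^ j) x = z := blockMap_pow_eq_of_under hL hU
      have key : blockMap M₁ z = blockMap M₁ (flm L j y) := by
        rw [← hzx, ← blockMap_pow_eq_flm L j y, blockMap_blockMap, blockMap_blockMap, mul_comm]
        exact hxy
      exact (mem_cube_iff hL).mpr ⟨flm L j y, sq_blockSat hM₁ hM₁ρ hM₁a hM₁M key hz, under_flm hL j y⟩
  · rw [cubeFam_of_lt top L a M ρ (by omega)] at hx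
    exact absurd hx (Set.notMem_empty _)

/-- **(1.4)₃ FOR THE SECT. F CUBE FAMILY**, `ℓ^∞` form with constants `R·M₁ ≤ ρ` (printed: `ρ = R₁M₁`, p. 98 «a distance
between boundaries of these cubes is equal to R₁M₁Lʲη»): `B8Eq131CubesAdmissible.sep_cube` BY NAME (a site outside `□_j` and
a site of `□_{j+1}` differ in some coordinate by `≥ ρLʲ + 1`). [cite: Balaban1985RegularSpaces, (1.4) p.77, p.98] -/
theorem metricClause14_cubeFam (top : Bool) {L : ℕ} (hL : 1 ≤ L) (a : Fin d → ℤ) (M : ℕ) {ρ : ℕ} (k : ℕ)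
    {R M₁ : ℕ} (hRM : R * M₁ ≤ ρ) : MetricClause14 supDist (cubeFam top L a M ρ k) k 1 L R M₁ := by
  intro j hj x hx y hy
  have hy' : y ∈ cube L a M ρ k (j + 1) := by
    rwa [cubeFam_of_pos top L a M ρ (by omega) (by omega)] at hy
  have hx' : x ∉ cube L a M ρ k j := by
    intro hxc
    apply hx
    by_cases h0 : top = true ∧ j = 0
    · obtain ⟨rfl, rfl⟩ := h0
      rw [cubeFam_true_zero]
      exact Set.mem_univ _
    · rw [cubeFam_eq_cube' top L a M ρ (le_of_lt hj) h0]
      exact hxc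
  obtain ⟨i, hi⟩ := sep_cube hj hx' hy'
  have h1 : (ρ : ℝ) * (L : ℝ) ^ j + 1 ≤ supDist x y := by
    rw [Int.abs_eq_natAbs] at hi
    have h' : ρ * L ^ j + 1 ≤ (x i - y i).natAbs := by exact_mod_cast hi
    have h'' : ((ρ * L ^ j + 1 : ℕ) : ℝ) ≤ ((x i - y i).natAbs : ℝ) := by exact_mod_cast h'
    push_cast at h''
    linarith [le_supDist x y i]
  have hL0 : (0 : ℝ) < (L : ℝ) ^ j := pow_pos (by exact_mod_cast hL) j
  rw [mul_one, ← div_eq_inv_mul, lt_div_iff₀ hL0]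
  have h2 : (R : ℝ) * M₁ * (L : ℝ) ^ j ≤ (ρ : ℝ) * (L : ℝ) ^ j := by
    have : R * M₁ * L ^ j ≤ ρ * L ^ j := Nat.mul_le_mul_right _ hRM
    exact_mod_cast this
  linarith

/-- **THE SECT. F FAMILY IS ADMISSIBLE IN THE SENSE OF (1.3)–(1.4)** (p. 99: «The sequence of cubes {□_j} is an admissible
family of subsets satisfying (1.3), (1.4)»): for `1 ≤ L ≤ ρ`, a block side `M₁ ≥ 1` with `M₁ ∣ ρ`, `M₁ ∣ a_μ`, `M₁ ∣ M`, and
`R·M₁ ≤ ρ`, the family `cubeFam top L a M ρ k` satisfies `Admissible134 L M₁ R k` — nesting and (1.4)₁ from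
`cubeFam_domainSeq`, (1.4)₂ from `sq_blockSat`, (1.4)₃ from `sep_cube`, all BY NAME.
[cite: Balaban1985RegularSpaces, (1.3)–(1.4) p.77, p.99] -/
theorem admissible134_cubeFam (top : Bool) {L : ℕ} (hL : 1 ≤ L) (a : Fin d → ℤ) (M : ℕ) {ρ : ℕ} (hρ : L ≤ ρ) (k : ℕ)
    {R M₁ : ℕ} (hM₁ : 1 ≤ M₁) (hM₁ρ : M₁ ∣ ρ) (hM₁a : ∀ i, (M₁ : ℤ) ∣ a i) (hM₁M : M₁ ∣ M) (hRM : R * M₁ ≤ ρ) :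
    Admissible134 L M₁ R k (cubeFam top L a M ρ k) where
  nested := (cubeFam_domainSeq top hL a M hρ k).anti
  beyond _ hj := cubeFam_of_lt top L a M ρ hj
  blockSat := (cubeFam_domainSeq top hL a M hρ k).sat
  bigCubes := bigCubes14_cubeFam top hL a M k hM₁ hM₁ρ hM₁a hM₁M
  metric := metricClause14_cubeFam top hL a M k hRM

/-- The same instance with print's constants: separation constant `ρ = R₁M₁` (p. 98), `R = R₁`, big blocks of side `M₁`
dividing the corner and the side of `□^{(k)}`. [cite: Balaban1985RegularSpaces, (1.3)–(1.4) p.77, p.98, p.99] -/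
theorem admissible134_cubeFam_printed (top : Bool) {L : ℕ} (hL : 1 ≤ L) (a : Fin d → ℤ) (M k : ℕ) {R₁ M₁ : ℕ}
    (hM₁ : 1 ≤ M₁) (hρ : L ≤ R₁ * M₁) (hM₁a : ∀ i, (M₁ : ℤ) ∣ a i) (hM₁M : M₁ ∣ M) :
    Admissible134 L M₁ R₁ k (cubeFam top L a M (R₁ * M₁) k) :=
  admissible134_cubeFam top hL a M hρ k hM₁ (dvd_mul_left M₁ R₁) hM₁a hM₁M le_rfl

/-- The trivial admissible family «Ω_j = T_η for j = 0, 1, …, k» (p. 77: *"we admit the case where some domains Ω_j are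
equal to T_η"*), `∅` beyond `k`. [cite: Balaban1985RegularSpaces, (1.3) p.77] -/
def univFam (k : ℕ) : ℕ → Set (Fin d → ℤ) := fun j => if j ≤ k then Set.univ else ∅

/-- `univFam` is admissible for all constants (every clause is vacuous or trivial) — non-vacuity of `Admissible134`.
[cite: Balaban1985RegularSpaces, (1.3)–(1.4) p.77] -/
theorem admissible134_univFam (L M₁ R k : ℕ) : Admissible134 L M₁ R k (univFam (d := d) k) where
  nested j x hx := by
    simp only [univFam, Set.mem_ite_empty_right, Set.mem_univ, and_true] at hx ⊢
    omega
  beyond j hj := by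
    simp only [univFam]
    rw [if_neg (by omega)]
  blockSat j x y _ hx := by
    simp only [univFam, Set.mem_ite_empty_right, Set.mem_univ, and_true] at hx ⊢
    exact hx
  bigCubes j x y _ hx := by
    simp only [univFam, Set.mem_ite_empty_right, Set.mem_univ, and_true] at hx ⊢
    exact hx
  metric j hj x hx y _ := by
    exfalso
    apply hx
    simp only [univFam, Set.mem_ite_empty_right, Set.mem_univ, and_true]
    omega

end Literature.MathematicalPhysics.QuantumFieldTheory.Balaban1983to89.B8Eq134Admissible
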